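import Literature.NumberTheory.NumberFields.NarrowClassGroupTwoRankOddClassNumber
import Literature.Geometry.Kaehler.ComplexTorusRealMultiplicationUnitSignatures
import Mathlib.NumberTheory.NumberField.Norm
import Mathlib.NumberTheory.NumberField.InfinitePlace.TotallyRealComplex
import Mathlib.FieldTheory.IsAlgClosed.Basic
import HarnessLib

/-!
# Totally positive units modulo squares cannot drop in a totally real extension:
# `#(U⁺/U²)(K) ∣ #(U⁺/U²)(L)` for number fields `K ⊆ L` with `L` totally real (Edgar–Mollin–Peterson, Thm. 2.1),
# hence the NARROW `2`-rank is monotone up totally real extensions with odd class numbers, and an EQUALITY of narrow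
# `2`-ranks is certified by ONE lower bound downstairs and ONE unit-signature bound upstairs

Topic `NumberTheory/NumberFields` (namespace = path).  THEOREM-ONLY file (no definition, no named fact, no instance, no `sorry`),
written by the prover seat `bsd-2adic-k4-w2` GEN 13 (cell `bsd-2adic`; `--supports` stmt-BirchSwinnertonDyer-22617: the per-row input of the
narrow-Fukuda rung `conjA_two_cubicModel_of_narrowRank_layer_succ_eq` (p747405) / `…_layer_models_eq` is ONE equality
`[Cl⁺(K_{m+1}) : Cl⁺(K_{m+1})²] = [Cl⁺(K_m) : Cl⁺(K_m)²]` between consecutive layers of the (totally real) cyclotomic `ℤ₂`-tower of a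
totally real cubic field; this file halves the kernel certificate of such an equality).

THE THEOREM ([EdgarMollinPeterson1986] Thm. 2.1: «Suppose `ℚ ⊆ K ⊆ L` with `L` totally real and finite over `ℚ`.  Then
`dim₂ U_K⁺/U_K² ≤ dim₂ U_L⁺/U_L²`»; they argue with the narrow and wide Hilbert class fields).  ELEMENTARY PROOF given here
(Fröhlich–Taylor V §1 signatures): for a real embedding `ρ` of `K` the real embeddings of `L` above `ρ` are the `K`-embeddings
`L → ℂ` (all real), so `ρ(N_{L/K} x) = ∏_{w | ρ} w(x)` (`realEmbedding_norm_eq_prod`) and the SIGN of `N_{L/K} u` at `ρ` is the SUM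
in `𝔽₂` of the signs of `u` above `ρ` (`signVec_unitsMap_norm`).  Hence the fibre-sum map `π : 𝔽₂^{Hom(L,ℝ)} → 𝔽₂^{Hom(K,ℝ)}` — onto,
because every real embedding of `K` extends (`exists_realEmbedding_comp_eq`) — carries the signature group `sign(U_L)` into
`sign(U_K)`; so `sign(U_L) ≤ π⁻¹(sign(U_K))` and the INDICES satisfy `[𝔽₂^{Hom(K,ℝ)} : sign(U_K)] ∣ [𝔽₂^{Hom(L,ℝ)} : sign(U_L)]`.
By `#(U⁺/U²) · #sign(U) = 2^{[F:ℚ]}` (tree `card_totPosUnitsModSq_mul_card_range_signVec`) these indices are `#(U⁺/U²)(K)` and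
`#(U⁺/U²)(L)` (`index_closure_range_signVec_eq_card_totPosUnitsModSq`).

CONSEQUENCES for fields with ODD class number (tree N1 `index_range_pow_two_narrowClassGroup_eq_card_totPosUnitsModSq_of_odd_classNumber`,
`[Cl⁺ : (Cl⁺)²] = #(U⁺/U²)`): ★ `index_range_pow_two_narrowClassGroup_dvd_of_odd_classNumber` — the narrow `2`-rank is MONOTONE
(`[Cl⁺(K):(Cl⁺(K))²] ∣ [Cl⁺(L):(Cl⁺(L))²]`; a JUMP of the narrow `2`-rank in a totally real tower with odd class numbers is permanent),
and ★ `index_range_pow_two_narrowClassGroup_eq_of_bounds` — the EQUALITY `[Cl⁺(L):(Cl⁺(L))²] = [Cl⁺(K):(Cl⁺(K))²] = 2^a` follows from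
`h(K)`, `h(L)` odd, `2^a ≤ #(U⁺/U²)(K)` (e.g. `a = 1`: ONE totally positive unit of `K` that is not the square of a unit, tree
`two_le_card_totPosUnitsModSq_of_not_sq`) and `2^b ≤ #sign(U_L)` with `a + b = [L:ℚ]` (`b` units of `L` with an invertible `b × b` sign
minor, tree `two_pow_le_card_range_signVec`) — NO sign matrix downstairs and NO non-square test upstairs.

* §1 `ite_prod_lt_zero_eq_sum` — the sign bit of a product of non-zero reals is the sum of the sign bits in `𝔽₂`.
* §2 `realEmbedding_norm_eq_prod`, `exists_realEmbedding_comp_eq` — real embeddings above a real embedding (`L` totally real).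
* §3 `signVec_unitsMap_norm` — `sign_ρ(N_{L/K} u) = Σ_{w | ρ} sign_w(u)`.
* §4 `index_closure_range_signVec_eq_card_totPosUnitsModSq`; ★ `card_totPosUnitsModSq_dvd_of_isTotallyReal`, `…_le_…` (EMP Thm. 2.1),
  `card_totPosUnitsModSq_eq_of_bounds`.
* §5 ★ `index_range_pow_two_narrowClassGroup_dvd_of_odd_classNumber`, `…_eq_of_odd_classNumber_of_card_le`, ★ `…_eq_of_bounds`.

References: [EdgarMollinPeterson1986] H. M. Edgar, R. A. Mollin, B. L. Peterson, *Class groups, totally positive units, and squares*,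
Proc. AMS 98 (1986) 33–37, Thm. 2.1 p. 34; [FrohlichTaylor1990] Ch. V §1 (1.10)–(1.13), pp. 163–164; [NeukirchANT1999] Ch. VI §1.
-/

noncomputable section

open scoped Classical NumberField
open NumberField

namespace Literature.NumberTheory.NumberFields

open Literature.Geometry.Kaehler.ComplexTorus

/-! ## §1 Sign bits of products -/

/-- **The sign bit of a product of non-zero reals is the sum of the sign bits in `𝔽₂`.**
[cite: FrohlichTaylor1990, Ch. V §1 (1.10) ("This gives a homomorphism"), p. 163] -/
theorem ite_prod_lt_zero_eq_sum {ι : Type*} (s : Finset ι) (f : ι → ℝ) (hf : ∀ i ∈ s, f i ≠ 0) :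
    (if ∏ i ∈ s, f i < 0 then (1 : ZMod 2) else 0) = ∑ i ∈ s, (if f i < 0 then (1 : ZMod 2) else 0) := by
  induction s using Finset.induction_on with
  | empty => simp
  | insert a s ha ih =>
    have hfa : f a ≠ 0 := hf a (Finset.mem_insert_self a s)
    have hfs : ∀ i ∈ s, f i ≠ 0 := fun i hi => hf i (Finset.mem_insert_of_mem hi)
    have hP : ∏ i ∈ s, f i ≠ 0 := Finset.prod_ne_zero_iff.mpr hfs
    rw [Finset.prod_insert ha, Finset.sum_insert ha, ← ih hfs]
    have h2 : (1 : ZMod 2) + 1 = 0 := by decide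
    rcases hfa.lt_or_gt with h1 | h1 <;> rcases hP.lt_or_gt with h3 | h3
    · rw [if_neg (not_lt.mpr (mul_pos_of_neg_of_neg h1 h3).le), if_pos h1, if_pos h3, h2]
    · rw [if_pos (mul_neg_of_neg_of_pos h1 h3), if_pos h1, if_neg (not_lt.mpr h3.le), add_zero]
    · rw [if_pos (mul_neg_of_pos_of_neg h1 h3), if_neg (not_lt.mpr h1.le), if_pos h3, zero_add]
    · rw [if_neg (not_lt.mpr (mul_pos h1 h3).le), if_neg (not_lt.mpr h1.le), if_neg (not_lt.mpr h3.le), add_zero]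

/-! ## §2 Real embeddings above a real embedding of the base (`L` totally real) -/

section Embeddings

variable {K L : Type} [Field K] [NumberField K] [Field L] [NumberField L] [Algebra K L]

/-- **`ρ(N_{L/K} x) = ∏_{w | ρ} w(x)`**: for `L` totally real and a real embedding `ρ` of `K`, the value of the relative norm at `ρ` is
the product of `x` over the real embeddings `w` of `L` restricting to `ρ` (these are exactly the `K`-embeddings `L → ℂ` for `ℂ` a
`K`-algebra through `ρ`, all of them real; Mathlib `Algebra.norm_eq_prod_embeddings`).
[cite: FrohlichTaylor1990, Ch. V §1 (1.14), p. 164] [cite: NeukirchANT1999, Ch. I §2 Prop. (2.6) (ii)] -/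
theorem realEmbedding_norm_eq_prod [IsTotallyReal L] (v : K →+* ℝ) (x : L) :
    v (Algebra.norm K x) = ∏ w ∈ Finset.univ.filter (fun w : L →+* ℝ => w.comp (algebraMap K L) = v), w x := by
  letI : Algebra K ℂ := (Complex.ofRealHom.comp v).toAlgebra
  -- the `K`-algebra maps `L → ℂ` are the real embeddings of `L` above `v`
  let e : {w : L →+* ℝ // w.comp (algebraMap K L) = v} ≃ (L →ₐ[K] ℂ) :=
    { toFun := fun w => ⟨Complex.ofRealHom.comp w.1, fun k => by
          have hk := RingHom.congr_fun w.2 k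
          rw [RingHom.comp_apply] at hk
          change ((w.1 (algebraMap K L k) : ℝ) : ℂ) = ((v k : ℝ) : ℂ)
          rw [hk]⟩
      invFun := fun σ => ⟨(IsTotallyReal.complexEmbedding_isReal (σ : L →+* ℂ)).embedding, by
          ext k
          apply Complex.ofReal_injective
          rw [RingHom.comp_apply, ComplexEmbedding.IsReal.coe_embedding_apply]
          exact σ.commutes k⟩
      left_inv := fun w => by
        apply Subtype.ext
        ext y
        apply Complex.ofReal_injective
        rw [ComplexEmbedding.IsReal.coe_embedding_apply]
        rfl
      right_inv := fun σ => by
        ext y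
        change ((((IsTotallyReal.complexEmbedding_isReal (σ : L →+* ℂ)).embedding y : ℝ)) : ℂ) = σ y
        rw [ComplexEmbedding.IsReal.coe_embedding_apply]
        rfl }
  apply Complex.ofReal_injective
  have h := Algebra.norm_eq_prod_embeddings K ℂ x
  change ((v (Algebra.norm K x) : ℝ) : ℂ) = _ at h
  rw [h, Complex.ofReal_prod, ← Fintype.prod_equiv e (fun w => ((w.1 x : ℝ) : ℂ)) (fun σ => σ x) (fun w => rfl)]
  exact (Finset.prod_subtype (Finset.univ.filter (fun w : L →+* ℝ => w.comp (algebraMap K L) = v)) (by simp)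
    (fun w : L →+* ℝ => ((w x : ℝ) : ℂ))).symm

/-- **Every real embedding of `K` extends to a real embedding of the totally real `L`** (extend to `L → ℂ` by algebraic closedness;
the extension is real because `L` is totally real). [cite: NeukirchANT1999, Ch. I §2 (after (2.6))] [cite: EdgarMollinPeterson1986, Thm. 2.1 (proof), p. 34] -/
theorem exists_realEmbedding_comp_eq [IsTotallyReal L] (v : K →+* ℝ) :
    ∃ w : L →+* ℝ, w.comp (algebraMap K L) = v := by
  letI : Algebra K ℂ := (Complex.ofRealHom.comp v).toAlgebra
  let σ : L →ₐ[K] ℂ := IsAlgClosed.lift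
  refine ⟨(IsTotallyReal.complexEmbedding_isReal (σ : L →+* ℂ)).embedding, ?_⟩
  ext k
  apply Complex.ofReal_injective
  rw [RingHom.comp_apply, ComplexEmbedding.IsReal.coe_embedding_apply]
  exact σ.commutes k

/-! ## §3 The signature of a relative norm -/

/-- **`sign_ρ(N_{L/K} u) = Σ_{w | ρ} sign_w(u)` in `𝔽₂`** for a unit `u` of the totally real `L` and a real embedding `ρ` of `K`.
[cite: FrohlichTaylor1990, Ch. V §1 (1.10)–(1.11), pp. 163–164] [cite: EdgarMollinPeterson1986, Thm. 2.1, p. 34] -/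
theorem signVec_unitsMap_norm [IsTotallyReal L] (u : (𝓞 L)ˣ) (v : K →+* ℝ) :
    signVec (Units.map (RingOfIntegers.norm K : 𝓞 L →* 𝓞 K) u) v =
      ∑ w ∈ Finset.univ.filter (fun w : L →+* ℝ => w.comp (algebraMap K L) = v), signVec u w := by
  simp only [signVec_apply]
  have hcoe : (((Units.map (RingOfIntegers.norm K : 𝓞 L →* 𝓞 K) u : (𝓞 K)ˣ) : 𝓞 K) : K) =
      Algebra.norm K (((u : (𝓞 L)ˣ) : 𝓞 L) : L) := by
    rw [Units.coe_map]; rfl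
  rw [hcoe, realEmbedding_norm_eq_prod]
  exact ite_prod_lt_zero_eq_sum _ _ (fun w _ => embedding_coe_units_ne_zero w u)

end Embeddings

/-! ## §4 `#(U⁺/U²)` is the index of the signature group; monotonicity -/

section Counting

variable {K : Type} [Field K] [NumberField K]

/-- **`[𝔽₂^{Hom(K,ℝ)} : sign(U_K)] = #(U⁺/U²)(K)`** for `K` totally real (`#(U⁺/U²) · #sign(U) = 2^{[K:ℚ]} = #𝔽₂^{Hom(K,ℝ)}`; the
signature group is stated as the subgroup CLOSURE of `sign(U_K)`, which is `sign(U_K)` itself).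
[cite: FrohlichTaylor1990, Ch. V §1 (1.12)–(1.13), p. 164] -/
theorem index_closure_range_signVec_eq_card_totPosUnitsModSq [IsTotallyReal K] :
    (AddSubgroup.closure (Set.range (signVec (K := K)))).index = Nat.card (TotPosUnitsModSq K) := by
  -- the range of the signature map is already a subgroup
  let H : AddSubgroup ((K →+* ℝ) → ZMod 2) :=
    { carrier := Set.range (signVec (K := K))
      zero_mem' := ⟨1, signVec_one⟩
      add_mem' := by
        rintro _ _ ⟨u, rfl⟩ ⟨u', rfl⟩
        exact ⟨u * u', signVec_mul u u'⟩
      neg_mem' := by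
        rintro _ ⟨u, rfl⟩
        refine ⟨u, ?_⟩
        funext σ
        rw [Pi.neg_apply, ZMod.neg_eq_self_mod_two] }
  have hcl : AddSubgroup.closure (Set.range (signVec (K := K))) = H := H.closure_eq
  rw [hcl]
  have h1 : H.index * Nat.card H = Nat.card ((K →+* ℝ) → ZMod 2) := H.index_mul_card
  have h2 : Nat.card ((K →+* ℝ) → ZMod 2) = 2 ^ Module.finrank ℚ K := by
    rw [Nat.card_fun, Nat.card_eq_fintype_card (α := ZMod 2), ZMod.card, Nat.card_eq_fintype_card, card_realEmbeddings]
  have h3 : Nat.card H = Nat.card (Set.range (signVec (K := K))) := rfl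
  have h4 := card_totPosUnitsModSq_mul_card_range_signVec (K := K)
  haveI : Nonempty (Set.range (signVec (K := K))) := ⟨⟨_, 1, rfl⟩⟩
  have hc : 0 < Nat.card (Set.range (signVec (K := K))) := Nat.card_pos
  rw [h3, h2, ← h4] at h1
  exact Nat.eq_of_mul_eq_mul_right hc h1

variable {L : Type} [Field L] [NumberField L] [Algebra K L]

/-- **Edgar–Mollin–Peterson, Thm. 2.1: `#(U⁺/U²)(K) ∣ #(U⁺/U²)(L)` for number fields `K ⊆ L` with `L` totally real** — the number
of totally positive units modulo squares (a power of `2`) cannot drop in a totally real extension.  Elementary proof: the fibre-sum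
map `π : 𝔽₂^{Hom(L,ℝ)} ↠ 𝔽₂^{Hom(K,ℝ)}` sends `sign(u)` to `sign(N_{L/K} u)`, so `sign(U_L) ≤ π⁻¹(sign(U_K))` and the indices divide.
[cite: EdgarMollinPeterson1986, Thm. 2.1, p. 34] [cite: FrohlichTaylor1990, Ch. V §1 (1.10)–(1.13), pp. 163–164] -/
theorem card_totPosUnitsModSq_dvd_of_isTotallyReal [IsTotallyReal L] :
    Nat.card (TotPosUnitsModSq K) ∣ Nat.card (TotPosUnitsModSq L) := by
  haveI : IsTotallyReal K := IsTotallyReal.of_algebra K L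
  -- a real embedding of `L` above each real embedding of `K`
  have hex : ∀ v : K →+* ℝ, ∃ w : L →+* ℝ, w.comp (algebraMap K L) = v := exists_realEmbedding_comp_eq
  choose c hc using hex
  -- the fibre-sum map
  let π : ((L →+* ℝ) → ZMod 2) →+ ((K →+* ℝ) → ZMod 2) :=
    { toFun := fun x v => ∑ w ∈ Finset.univ.filter (fun w : L →+* ℝ => w.comp (algebraMap K L) = v), x w
      map_zero' := by
        funext v
        simp only [Pi.zero_apply, Finset.sum_const_zero]
      map_add' := fun x y => by
        funext v
        simp only [Pi.add_apply, Finset.sum_add_distrib] }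
  have hπsurj : Function.Surjective π := by
    intro y
    refine ⟨fun w => if w = c (w.comp (algebraMap K L)) then y (w.comp (algebraMap K L)) else 0, ?_⟩
    funext v
    change ∑ w ∈ Finset.univ.filter (fun w : L →+* ℝ => w.comp (algebraMap K L) = v),
      (if w = c (w.comp (algebraMap K L)) then y (w.comp (algebraMap K L)) else 0) = y v
    rw [Finset.sum_eq_single (c v)]
    · rw [hc v, if_pos rfl]
    · intro w hw hne
      have hwv : w.comp (algebraMap K L) = v := (Finset.mem_filter.mp hw).2
      rw [hwv, if_neg hne]
    · intro h
      have hmem : c v ∈ Finset.univ.filter (fun w : L →+* ℝ => w.comp (algebraMap K L) = v) :=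
        Finset.mem_filter.mpr ⟨Finset.mem_univ _, hc v⟩
      exact absurd hmem h
  have hle : AddSubgroup.closure (Set.range (signVec (K := L))) ≤
      (AddSubgroup.closure (Set.range (signVec (K := K)))).comap π := by
    rw [AddSubgroup.closure_le]
    rintro _ ⟨u, rfl⟩
    rw [AddSubgroup.coe_comap, Set.mem_preimage, SetLike.mem_coe]
    apply AddSubgroup.subset_closure
    refine ⟨Units.map (RingOfIntegers.norm K : 𝓞 L →* 𝓞 K) u, ?_⟩
    funext v
    rw [signVec_unitsMap_norm]
    rfl
  have h1 := AddSubgroup.index_dvd_of_le hle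
  rw [AddSubgroup.index_comap_of_surjective _ hπsurj, index_closure_range_signVec_eq_card_totPosUnitsModSq,
    index_closure_range_signVec_eq_card_totPosUnitsModSq] at h1
  exact h1

/-- **`#(U⁺/U²)(K) ≤ #(U⁺/U²)(L)`** for number fields `K ⊆ L` with `L` totally real (Edgar–Mollin–Peterson Thm. 2.1 in its printed
`dim₂` form: both sides are powers of `2`). [cite: EdgarMollinPeterson1986, Thm. 2.1, p. 34] -/
theorem card_totPosUnitsModSq_le_of_isTotallyReal [IsTotallyReal L] :
    Nat.card (TotPosUnitsModSq K) ≤ Nat.card (TotPosUnitsModSq L) :=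
  Nat.le_of_dvd (card_totPosUnitsModSq_pos L) card_totPosUnitsModSq_dvd_of_isTotallyReal

/-- **Equality of `#(U⁺/U²)` along `K ⊆ L` (`L` totally real) from ONE bound at each end**: if `2^a ≤ #(U⁺/U²)(K)` (e.g. `a`
independent totally positive non-square unit classes of `K`) and `2^b ≤ #sign(U_L)` (`b` units of `L` with independent signatures)
with `a + b = [L:ℚ]`, then `#(U⁺/U²)(L) = #(U⁺/U²)(K) = 2^a` (`#(U⁺/U²)(L) · #sign(U_L) = 2^{[L:ℚ]}` and Thm. 2.1).
[cite: EdgarMollinPeterson1986, Thm. 2.1, p. 34] [cite: FrohlichTaylor1990, Ch. V §1 (1.12)–(1.13), p. 164] -/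
theorem card_totPosUnitsModSq_eq_of_bounds [IsTotallyReal L] {a b : ℕ} (hab : a + b = Module.finrank ℚ L)
    (hlow : 2 ^ a ≤ Nat.card (TotPosUnitsModSq K)) (hsig : 2 ^ b ≤ Nat.card (Set.range (signVec (K := L)))) :
    Nat.card (TotPosUnitsModSq L) = Nat.card (TotPosUnitsModSq K) ∧ Nat.card (TotPosUnitsModSq K) = 2 ^ a := by
  have hmono : Nat.card (TotPosUnitsModSq K) ≤ Nat.card (TotPosUnitsModSq L) := card_totPosUnitsModSq_le_of_isTotallyReal
  have h := card_totPosUnitsModSq_mul_card_range_signVec (K := L)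
  rw [← hab, pow_add] at h
  -- `#(U⁺/U²)(L) ≤ 2^a`
  have hup : Nat.card (TotPosUnitsModSq L) ≤ 2 ^ a := by
    have hle : Nat.card (TotPosUnitsModSq L) * 2 ^ b ≤ 2 ^ a * 2 ^ b := by
      calc Nat.card (TotPosUnitsModSq L) * 2 ^ b ≤ Nat.card (TotPosUnitsModSq L) * Nat.card (Set.range (signVec (K := L))) :=
            Nat.mul_le_mul_left _ hsig
        _ = 2 ^ a * 2 ^ b := h
    exact Nat.le_of_mul_le_mul_right hle (pow_pos two_pos b)
  constructor <;> omega

end Counting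

/-! ## §5 Narrow class groups: the narrow `2`-rank is monotone up totally real extensions with odd class numbers -/

section Narrow

variable {K L : Type} [Field K] [NumberField K] [Field L] [NumberField L] [Algebra K L]

/-- ★ **The narrow `2`-rank is MONOTONE: `[Cl⁺(K):(Cl⁺(K))²] ∣ [Cl⁺(L):(Cl⁺(L))²]`** for number fields `K ⊆ L` with `L` totally real and
`h(K)`, `h(L)` odd (then `[Cl⁺:(Cl⁺)²] = #(U⁺/U²)`, tree N1, and Edgar–Mollin–Peterson Thm. 2.1 applies).  In the totally real cyclotomic
`ℤ₂`-tower of a totally real field with odd class numbers a JUMP of the narrow `2`-rank is therefore permanent.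
[cite: EdgarMollinPeterson1986, Thm. 2.1, p. 34] [cite: FrohlichTaylor1990, Ch. V §1 (1.8)–(1.13), pp. 163–164] -/
theorem index_range_pow_two_narrowClassGroup_dvd_of_odd_classNumber [IsTotallyReal L]
    (hK : Odd (classNumber K)) (hL : Odd (classNumber L)) :
    (powMonoidHom (α := NarrowClassGroup K) 2).range.index ∣ (powMonoidHom (α := NarrowClassGroup L) 2).range.index := by
  haveI : IsTotallyReal K := IsTotallyReal.of_algebra K L
  rw [index_range_pow_two_narrowClassGroup_eq_card_totPosUnitsModSq_of_odd_classNumber hK,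
    index_range_pow_two_narrowClassGroup_eq_card_totPosUnitsModSq_of_odd_classNumber hL]
  exact card_totPosUnitsModSq_dvd_of_isTotallyReal

/-- **EQUALITY of narrow `2`-ranks from ONE inequality**: `K ⊆ L`, `L` totally real, `h(K)`, `h(L)` odd and `#(U⁺/U²)(L) ≤ #(U⁺/U²)(K)`
⟹ `[Cl⁺(L):(Cl⁺(L))²] = [Cl⁺(K):(Cl⁺(K))²]` (the reverse inequality is Thm. 2.1).
[cite: EdgarMollinPeterson1986, Thm. 2.1, p. 34] [cite: FrohlichTaylor1990, Ch. V §1 (1.12)–(1.13), p. 164] -/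
theorem index_range_pow_two_narrowClassGroup_eq_of_odd_classNumber_of_card_le [IsTotallyReal L]
    (hK : Odd (classNumber K)) (hL : Odd (classNumber L))
    (hle : Nat.card (TotPosUnitsModSq L) ≤ Nat.card (TotPosUnitsModSq K)) :
    (powMonoidHom (α := NarrowClassGroup L) 2).range.index = (powMonoidHom (α := NarrowClassGroup K) 2).range.index := by
  haveI : IsTotallyReal K := IsTotallyReal.of_algebra K L
  rw [index_range_pow_two_narrowClassGroup_eq_card_totPosUnitsModSq_of_odd_classNumber hK,
    index_range_pow_two_narrowClassGroup_eq_card_totPosUnitsModSq_of_odd_classNumber hL]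
  exact le_antisymm hle card_totPosUnitsModSq_le_of_isTotallyReal

/-- ★ **The halved KERNEL CERTIFICATE of an equality of narrow `2`-ranks**: `K ⊆ L` number fields, `L` totally real, `h(K)` and `h(L)`
odd, `2^a ≤ #(U⁺/U²)(K)` (downstairs: `a` independent totally positive non-square unit classes — for `a = 1` ONE totally positive unit
that is not the square of a unit, tree `two_le_card_totPosUnitsModSq_of_not_sq`) and `2^b ≤ #sign(U_L)` (upstairs: `b` units with an
invertible `b × b` sign minor, tree `two_pow_le_card_range_signVec`) with `a + b = [L:ℚ]` ⟹
`[Cl⁺(L):(Cl⁺(L))²] = [Cl⁺(K):(Cl⁺(K))²] = 2^a`.  No sign matrix is needed downstairs and no non-square test upstairs.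
[cite: EdgarMollinPeterson1986, Thm. 2.1, p. 34] [cite: FrohlichTaylor1990, Ch. V §1 (1.8)–(1.13), pp. 163–164] -/
theorem index_range_pow_two_narrowClassGroup_eq_of_bounds [IsTotallyReal L]
    (hK : Odd (classNumber K)) (hL : Odd (classNumber L)) {a b : ℕ} (hab : a + b = Module.finrank ℚ L)
    (hlow : 2 ^ a ≤ Nat.card (TotPosUnitsModSq K)) (hsig : 2 ^ b ≤ Nat.card (Set.range (signVec (K := L)))) :
    (powMonoidHom (α := NarrowClassGroup L) 2).range.index = (powMonoidHom (α := NarrowClassGroup K) 2).range.index ∧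
      (powMonoidHom (α := NarrowClassGroup K) 2).range.index = 2 ^ a := by
  haveI : IsTotallyReal K := IsTotallyReal.of_algebra K L
  rw [index_range_pow_two_narrowClassGroup_eq_card_totPosUnitsModSq_of_odd_classNumber hK,
    index_range_pow_two_narrowClassGroup_eq_card_totPosUnitsModSq_of_odd_classNumber hL]
  exact card_totPosUnitsModSq_eq_of_bounds hab hlow hsig

end Narrow

/-! ## §6 Intermediate fields `F₁ ≤ F₂` of a common extension (the shape of concrete layer models inside `ℚ̄`) -/

section IntermediateFields

variable {E : Type} [Field E] [CharZero E] {F₁ F₂ : IntermediateField ℚ E}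

/-- **Thm. 2.1 for intermediate fields `F₁ ≤ F₂` of one ambient field** (`F₂` a totally real number field; the `Algebra F₁ F₂` structure is
the inclusion): `#(U⁺/U²)(F₁) ∣ #(U⁺/U²)(F₂)`. [cite: EdgarMollinPeterson1986, Thm. 2.1, p. 34] -/
theorem card_totPosUnitsModSq_dvd_of_le (h12 : F₁ ≤ F₂) [NumberField F₁] [NumberField F₂] [IsTotallyReal F₂] :
    Nat.card (TotPosUnitsModSq F₁) ∣ Nat.card (TotPosUnitsModSq F₂) := by
  letI : Algebra F₁ F₂ := (IntermediateField.inclusion h12).toRingHom.toAlgebra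
  exact card_totPosUnitsModSq_dvd_of_isTotallyReal

/-- ★ **The halved certificate for concrete layer models `F₁ ≤ F₂ ⊂ E`** (e.g. `ℚ(θ) ⊔ ℚ_m ≤ ℚ(θ) ⊔ ℚ_{m+1}` inside `ℚ̄`): `F₂` a totally real
number field, `h(F₁)`, `h(F₂)` odd, `2^a ≤ #(U⁺/U²)(F₁)`, `2^b ≤ #sign(U_{F₂})`, `a + b = [F₂:ℚ]` ⟹
`[Cl⁺(F₂):(Cl⁺(F₂))²] = [Cl⁺(F₁):(Cl⁺(F₁))²] = 2^a` — the `hr` of the concrete-model narrow-Fukuda rung.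
[cite: EdgarMollinPeterson1986, Thm. 2.1, p. 34] [cite: FrohlichTaylor1990, Ch. V §1 (1.8)–(1.13), pp. 163–164] -/
theorem index_range_pow_two_narrowClassGroup_eq_of_bounds_of_le (h12 : F₁ ≤ F₂) [NumberField F₁] [NumberField F₂]
    [IsTotallyReal F₂] (hK : Odd (classNumber F₁)) (hL : Odd (classNumber F₂)) {a b : ℕ} (hab : a + b = Module.finrank ℚ F₂)
    (hlow : 2 ^ a ≤ Nat.card (TotPosUnitsModSq F₁)) (hsig : 2 ^ b ≤ Nat.card (Set.range (signVec (K := F₂)))) :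
    (powMonoidHom (α := NarrowClassGroup F₂) 2).range.index = (powMonoidHom (α := NarrowClassGroup F₁) 2).range.index ∧
      (powMonoidHom (α := NarrowClassGroup F₁) 2).range.index = 2 ^ a := by
  letI : Algebra F₁ F₂ := (IntermediateField.inclusion h12).toRingHom.toAlgebra
  exact index_range_pow_two_narrowClassGroup_eq_of_bounds hK hL hab hlow hsig

/-- **Monotonicity for concrete layer models `F₁ ≤ F₂ ⊂ E`** with odd class numbers: `[Cl⁺(F₁):(Cl⁺(F₁))²] ∣ [Cl⁺(F₂):(Cl⁺(F₂))²]`.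
[cite: EdgarMollinPeterson1986, Thm. 2.1, p. 34] -/
theorem index_range_pow_two_narrowClassGroup_dvd_of_le (h12 : F₁ ≤ F₂) [NumberField F₁] [NumberField F₂] [IsTotallyReal F₂]
    (hK : Odd (classNumber F₁)) (hL : Odd (classNumber F₂)) :
    (powMonoidHom (α := NarrowClassGroup F₁) 2).range.index ∣ (powMonoidHom (α := NarrowClassGroup F₂) 2).range.index := by
  letI : Algebra F₁ F₂ := (IntermediateField.inclusion h12).toRingHom.toAlgebra
  exact index_range_pow_two_narrowClassGroup_dvd_of_odd_classNumber hK hL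

end IntermediateFields

end Literature.NumberTheory.NumberFields

end
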